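import Summits.ABC.ABC.Theorems.IUTThetaPilotThetaPartIIStubHullRegimeAboveNecessary
import Summits.ABC.ABC.Theorems.IUTThetaPilotThetaPartIIStubThetaData
import Summits.ABC.IUTFork.LDHSplitPairSlackPoint
import Summits.ABC.IUTFork.LDHLopsidedWitnessHeights
import Summits.ABC.IUTFork.LDHLopsidedWitnessPrime
import Summits.ABC.IUTFork.Conditional.AbcOfSHvolAdmissibleWindowContent
import Literature.IUT.LogVolume.Corollary22FullGaloisImage
import HarnessLib

/-!
# Crux `ThetaPartII` (stmt-ABC-19678, route `IUTThetaPilot`), (U) line: abc-iut-S4's DATUM-LEVEL pair bound with the slack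
# FAILS at every genuine Θ-volume datum of an explicit admissible point of the `λ`-line over `ℚ(i)` — a second, independent
# witness against the (expired) registered stub `stub_hullRegimeAbove`, in abc-iut-S4's own currency

Proof-only NEGATIVE-side record file (D-0012; 0 definitions, no `Prop` fact) of the abc-iut cell (seat abc-iut-w5-d126, gen 5;
row «HABOVE-LOPSIDED-WITNESS»; VERDICT RISK ¶7). TAKES NO SIDE on [IUTchIII] Cor. 3.12 or on [IUTchIV] Thm. 1.10 as printed:
it is a statement about the cell's TYPED (U)-reading objects ((Ind1) = all capsule-index permutations, abc-iut-c312-d1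
`plan/c312/STEPV-IND1-NOTE.md` R2). S. Mochizuki, *IUT IV* [Mochizuki2012], Thm. 1.10 Steps (ii), (v), (viii)
(kurims pp. 24–29), Cor. 2.2 (ii) proof (P1)–(P7) pp. 44–46; Dupuy–Hilado [DupuyHilado2025] §3.3, §3.6, §4.7, §4.12.

CONTEXT. abc-iut-S4 (p447630, `ThetaPartII.pair_le_slack_of_stub_hullRegimeAbove`) proved the NECESSARY CONDITION of the
stub `stub_hullRegimeAbove` of skeleton `0bf3ba3d3910cd8b` (abc-iut-c312-8 RESHAPE-3): at every admissible `(P, l)` with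
`2 ≤ d_mod`, above abc-iut-c312-d1's threshold, with `4·d_mod ≤ l + 5`, EVERY genuine datum `T` satisfies, for every support
prime `p` and places `v, w` of `F_mod(E_F)` over `p`,
`Pr(v)Pr(w)(l(l+1)/12)(μ_T(v) − μ_T(w)) ≤ B(P,l) − ((l+5)/4 − d_mod)(log-diff + (1 − 1/l) log-cond)` (the «slack»), and recorded
(13:11:22Z) the inhabitation of its failure as «the ONE computational question left on the (U) line … (P2) needs the
multiplicity profile of λ, 1−λ: not certifiable in practice». The stub itself was meanwhile refuted FIRST by abc-iut-s2-p5 gen 2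
(`Negative.stub_hullRegimeAbove_false`, p455039, the `ℚ(√2)` family at the mixed prime `7` through abc-iut-s2-p1's point-level
mixed-share currency and abc-iut-s2-p3's (P1)-window prime), and the skeleton of record moved to RESHAPE-4 (`3177a83aca8d622d`,
guarded stubs `stub_cor312Bad` / `stub_hullRegimeAboveBad`, which this file does NOT touch).

THIS FILE (`exists_gaussian_noDatumPairBound`) answers abc-iut-S4's question IN ITS OWN CURRENCY by an INDEPENDENT witness:
there are an admissible `(P, l)` — `P = (ℚ(i), λ_k)`, `λ_k = π^{2k}/(2π^{2k}+1)`, `π = 2 + i`, `k = 10^{23} + ⌈|H_K|⌉ + 1`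
(`H_K` of `Cor22.condP6_of_seven_le (CBData.std ∅)`), `l` a prime with `10^{13} < l ≤ k/(5·10^8)` — with `P ∈ UP`, a core,
(P2), (P5), (P6), `d_mod = 2`, above the threshold, carrying a genuine datum (abc-iut-L5-t7 `ThetaPartII.stub_thetaData`), such
that NO genuine datum `T` at `(P, l)` satisfies S4's datum-level pair bound with the slack. INGREDIENTS (parts I–V of the series
`Summits/ABC/IUTFork/LDHLopsidedWitness{Point,Orders,Admissible,Heights,Prime}`, and `LDHSplitPairSlackPoint`): the pole `V ∋ π`
over `5` of depth `ord_V j(λ_k) ≤ −4k` with GOOD conjugate `W ∋ π̄` (`π^{2k} ≡ 1 mod W`); (P2) WITHOUT factorising — `l` divides no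
local height because the primes `> 10^{13}` dividing the local heights have `Σ log l ≤ (log L/L)·Σ_v h_v ≤ (log L/L)(28k + 12)`
(`−ord_U j ≤ 2·ord_U(π^{2k}(2π^{2k}+1)(π^{2k}+1))`, product formula) `< θ(k/(5·10^8)) − θ(10^{13})` (Mathlib's Chebyshev bounds)
— a window-FREE counting that needs no (P1) window; (P6) via `λ_k → 1/2 ∈ K_V = std ∅` and `log q^∀ ≥ 2k log 5 > H_K`; the
threshold via `log N·π(N) ≤ 5N` (abc-iut-s2-p3 `Cor22Window.log_mul_primeCounting_le`); and the contradiction: a datum-level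
pair bound with constant `S` transports to `(l+1)·2k·log 5/48 ≤ S` at the split prime `5` (`PointDict.splitDepth_le_of_datumPair`),
while `slack(P,l) < (l+1)·2k·log 5/48` (`LopsidedWitness.slack_lt_pair`; log-diff `= (log 4)/2`, log-cond `≤ log(6·125^k)`). NO
abc-violating configuration: `λ_k` is an ordinary point; the violation is the `l²` of the typed (Ind1) slot residue at a prime of
`F_mod` split into a DEEP bad place and a GOOD place against a slack linear in `l`.

From this theorem `Negative.stub_hullRegimeAbove_false` follows again in one line (feed the stub to p447630 and the result to
the last conjunct) — not re-landed here (abc-iut-s2-p5's is the declaration of record). READING (neutral): a statement about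
OUR typed (U)-objects; nothing about [IUTchIII] Cor. 3.12, nothing about [IUTchIV] Thm. 1.10 under another (Ind1) reading (R3),
nothing about the guarded RESHAPE-4 stubs, nothing about abc. typed ≠ proved; [claim: Mochizuki2012, status: disputed] for every
IUT quotation. [cite: Mochizuki2012, IUTchIV Thm. 1.10 Steps (ii), (v), (viii) p. 24–29]
[cite: Mochizuki2012, IUTchIV Cor. 2.2 (ii) proof p. 44–46] [cite: DupuyHilado2025, §3.3, §3.6, §4.7, §4.12] PROOF-ONLY file.
-/

noncomputable section

-- `Summit.<Summit>.<Problem>` is the mandated summit-side namespace (CONVENTIONS §2); for the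
-- single-conjunct summit `ABC` the two coincide, so the duplicate `ABC.ABC` is deliberate.
set_option linter.dupNamespace false

namespace Summit.ABC.ABC.Theorems.ThetaPartII.Negative

open Literature.NumberTheory.DiophantineGeometry.GenEll Literature.IUT.LogVolume Literature.IUT.HodgeTheaters
open Literature.NumberTheory.DiophantineGeometry
open Summit.ABC.IUTFork Summit.ABC.IUTFork.LopsidedWitness NumberField IsDedekindDomain
open scoped Nat.Prime

/-- **At an explicit admissible `(P, l)` over `ℚ(i)` above the threshold, NO genuine Θ-volume datum satisfies abc-iut-S4's
datum-level pair bound with the slack** (`P = (ℚ(i), λ_k)`, `λ_k = π^{2k}/(2π^{2k}+1)`, `π = 2+i`, `k = 10^{23} + ⌈|H_K|⌉ + 1`;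
`l` a prime `> 10^{13}` with `5·10^8·l ≤ k` chosen by Chebyshev counting; `P ∈ UP`, core, (P2), (P5), (P6), `d_mod = 2`, the
threshold of abc-iut-c312-d1, and a datum exists). The negated bound is VERBATIM the per-datum conclusion of abc-iut-S4's
`ThetaPartII.pair_le_slack_of_stub_hullRegimeAbove` (p447630). A statement about the cell's typed (U)-objects; no side taken on
[IUTchIII] Cor. 3.12 / [IUTchIV] Thm. 1.10 as printed. [cite: Mochizuki2012, IUTchIV Thm. 1.10 Step (v) p. 27–29]
[cite: Mochizuki2012, IUTchIV Cor. 2.2 (ii) proof p. 44–46] [claim: Mochizuki2012, status: disputed] -/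
theorem exists_gaussian_noDatumPairBound :
    ∃ (P : NFPoint) (l : ℕ), P ∈ UP ∧ l.Prime ∧ (10 : ℕ) ^ 13 < l ∧ Cor22.AdmitsCore P ∧ Cor22.CondP2 P l ∧
      Cor22.CondP5 P l ∧ Cor22.CondP6 P l ∧ Cor22.dmod P = 2 ∧
      40 * Real.log (((2 ^ 12 * 3 ^ 3 * 5 * Cor22.dmod P : ℕ) : ℝ) * l)
          * ((Nat.primeCounting (2 ^ 12 * 3 ^ 3 * 5 * Cor22.dmod P * l) : ℝ)
            - (2 * (Cor22.dmod P : ℝ) * (P.logDiff + Cor22.logCondAvoid P {2, l}) + Real.log (2 * 3 * 5 * (l : ℝ)))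
              / Real.log 2) < Cor22.logQAvoid P {2, l} ∧
      Nonempty (Cor22.ThetaVolumeDatumAt P l) ∧
      ∀ T : Cor22.ThetaVolumeDatumAt P l,
        ¬ (letI := T.instFieldF; letI := T.instNumberFieldF; letI := T.instAlgebraF; letI := T.instFieldK
           letI := T.instNumberFieldK; letI := T.instAlgebraK; letI := T.instFieldFbar; letI := T.instAlgebraFbar
           letI := T.instAlgebraKFbar; letI := T.instIsElliptic
           ∀ (p : ℕ) [Fact p.Prime], p ∈ T.I.supportPrimes → ∀ v w : placesOver (fieldOfModuli T.E) p,
             weight (fieldOfModuli T.E) v.1 * weight (fieldOfModuli T.E) w.1 * ((l : ℝ) * ((l : ℝ) + 1) / 12) *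
                 (T.I.X.qPilot v.1 * logNorm (fieldOfModuli T.E) v.1 / (localDegree (fieldOfModuli T.E) v.1 : ℝ)
                   - T.I.X.qPilot w.1 * logNorm (fieldOfModuli T.E) w.1 /
                     (localDegree (fieldOfModuli T.E) w.1 : ℝ)) ≤
               ((l : ℝ) + 1) / 4 *
                   ((1 + 12 * (Cor22.dmod P : ℝ) / l) * (P.logDiff + Cor22.logCondAvoid P {2, l})
                     + 2 * Real.log l + 52
                     + 20 / 3 * Real.log (((2 ^ 12 * 3 ^ 3 * 5 * Cor22.dmod P : ℕ) : ℝ) * (l : ℝ))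
                       * (Nat.primeCounting (2 ^ 12 * 3 ^ 3 * 5 * Cor22.dmod P * l) : ℝ))
                 - (((l : ℝ) + 5) / 4 - (Cor22.dmod P : ℝ)) *
                     (P.logDiff + (1 - 1 / (l : ℝ)) * Cor22.logCondAvoid P {2, l})) := by
  classical
  -- the field `ℚ(i)` and a primitive fourth root of unity in its ring of integers
  haveI hcyc : IsCyclotomicExtension {4} ℚ (CyclotomicField 4 ℚ) := CyclotomicField.isCyclotomicExtension 4 ℚ
  have hζ := (IsCyclotomicExtension.zeta_spec 4 ℚ (CyclotomicField 4 ℚ)).toInteger_isPrimitiveRoot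
  set ζ : 𝓞 (CyclotomicField 4 ℚ) := (IsCyclotomicExtension.zeta_spec 4 ℚ (CyclotomicField 4 ℚ)).toInteger with hζdef
  haveI : Fact (Nat.Prime 5) := ⟨by norm_num⟩
  -- the constant of (P4) ⇒ (P6) on the compact domain `std ∅`, and the depth parameter `k`
  obtain ⟨HK, hHK⟩ := Cor22.condP6_of_seven_le (CBData.std ∅ (by simp))
  -- `k` is kept OPAQUE (no unfolding of `10^23` in later arithmetic)
  obtain ⟨k, hk23, hk1, hkHK⟩ : ∃ k : ℕ, (10 : ℕ) ^ 23 ≤ k ∧ 1 ≤ k ∧ |HK| < k := by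
    refine ⟨10 ^ 23 + ⌈|HK|⌉₊ + 1, by omega, by omega, ?_⟩
    have h1 : |HK| ≤ ⌈|HK|⌉₊ := Nat.le_ceil _
    have h2 : ((⌈|HK|⌉₊ : ℕ) : ℝ) + 1 ≤ ((10 ^ 23 + ⌈|HK|⌉₊ + 1 : ℕ) : ℝ) := by
      push_cast; linarith [pow_nonneg (by norm_num : (0 : ℝ) ≤ 10) 23]
    linarith
  -- the point and its data
  set x : CyclotomicField 4 ℚ := (2 + (ζ : CyclotomicField 4 ℚ)) ^ (2 * k) / (2 * (2 + (ζ : CyclotomicField 4 ℚ)) ^ (2 * k) + 1)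
    with hx
  obtain ⟨V, W, hVW, hV, hW, hUP, htop, hdmod, hcore, hP5all, hjv, hjw, h2V, hlV, hnV, hwV, hwW, hlogV⟩ :=
    point_data hζ hk1
  set P : NFPoint := ⟨CyclotomicField 4 ℚ, x⟩ with hP
  -- the local heights of the poles, and their budget `≤ 28k + 12`
  set y : CyclotomicField 4 ℚ :=
    ((((2 + ζ) ^ (2 * k) * (2 * (2 + ζ) ^ (2 * k) + 1) * ((2 + ζ) ^ (2 * k) + 1) : 𝓞 (CyclotomicField 4 ℚ))) :
      CyclotomicField 4 ℚ) with hy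
  set Ty := (finite_setOf_ord_ne_zero (CyclotomicField 4 ℚ) y).toFinset with hTy
  set s := Ty.filter (fun U => ord (CyclotomicField 4 ℚ) U (Cor22.jInv x) < 0) with hs
  set hgt : HeightOneSpectrum (𝓞 (CyclotomicField 4 ℚ)) → ℕ :=
    fun U => (-ord (CyclotomicField 4 ℚ) U (Cor22.jInv x)).toNat with hhgt
  have hpos : ∀ U ∈ s, 0 < hgt U := by
    intro U hU
    have h := (Finset.mem_filter.mp hU).2
    simp only [hhgt]
    omega
  have hbudget : ∑ U ∈ s, (hgt U : ℝ) ≤ 37 * k + 12 := by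
    -- `Σ_{U ∈ s} h_U ≤ 2·Σ_{U ∈ Ty} ord_U(y) ≤ 4·log(6·125^k)/log 2 ≤ 28k + 12`
    have h1 : ∑ U ∈ s, (hgt U : ℝ) ≤ ∑ U ∈ s, 2 * (ord (CyclotomicField 4 ℚ) U y : ℝ) := by
      refine Finset.sum_le_sum fun U hU => ?_
      have hneg := (Finset.mem_filter.mp hU).2
      have hle := neg_ord_jInv_le hζ hk1 U
      rw [← hy, ← hx] at hle
      simp only [hhgt]
      have e : (((-ord (CyclotomicField 4 ℚ) U (Cor22.jInv x)).toNat : ℕ) : ℝ) =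
          ((-ord (CyclotomicField 4 ℚ) U (Cor22.jInv x) : ℤ) : ℝ) := by
        have h0 : (0 : ℤ) ≤ -ord (CyclotomicField 4 ℚ) U (Cor22.jInv x) := by omega
        have h1 := Int.toNat_of_nonneg h0
        exact_mod_cast h1
      rw [e]
      exact_mod_cast hle
    have h2 : ∑ U ∈ s, 2 * (ord (CyclotomicField 4 ℚ) U y : ℝ) ≤ ∑ U ∈ Ty, 2 * (ord (CyclotomicField 4 ℚ) U y : ℝ) :=
      Finset.sum_le_sum_of_subset_of_nonneg (Finset.filter_subset _ _) fun U _ _ =>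
        mul_nonneg (by norm_num) (by rw [hy]; exact_mod_cast ord_nonneg_of_isIntegral (CyclotomicField 4 ℚ) U _)
    have h3 := sum_ord_le hζ hk1
    rw [← hy, ← hTy] at h3
    have h4 : ∑ U ∈ Ty, 2 * (ord (CyclotomicField 4 ℚ) U y : ℝ) ≤ 2 * (2 * Real.log (6 * 125 ^ k) / Real.log 2) := by
      rw [← Finset.mul_sum]; exact mul_le_mul_of_nonneg_left h3 (by norm_num)
    -- `log(6·125^k) ≤ log 8 + k·log 128 = (3 + 7k)·log 2`
    have hlog2 : 0 < Real.log 2 := Real.log_pos (by norm_num)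
    have h5 : Real.log (6 * 125 ^ k) ≤ (3 + 7 * k) * Real.log 2 := by
      have e : (3 + 7 * (k : ℝ)) * Real.log 2 = Real.log (8 * 128 ^ k) := by
        rw [Real.log_mul (by norm_num) (by positivity), Real.log_pow,
          show (8 : ℝ) = 2 ^ 3 by norm_num, show (128 : ℝ) = 2 ^ 7 by norm_num, Real.log_pow, Real.log_pow]
        push_cast; ring
      rw [e]
      exact Real.log_le_log (by positivity)
        (mul_le_mul (by norm_num) (pow_le_pow_left₀ (by norm_num) (by norm_num) k) (by positivity) (by norm_num))
    have h6 : 2 * (2 * Real.log (6 * 125 ^ k) / Real.log 2) ≤ 28 * k + 12 := by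
      rw [show (2 : ℝ) * (2 * Real.log (6 * 125 ^ k) / Real.log 2) = 4 * Real.log (6 * 125 ^ k) / Real.log 2 by ring,
        div_le_iff₀ hlog2]
      calc 4 * Real.log (6 * 125 ^ k) ≤ 4 * ((3 + 7 * (k : ℝ)) * Real.log 2) := by linarith
        _ = (28 * (k : ℝ) + 12) * Real.log 2 := by ring
    have hk0 : (0 : ℝ) ≤ k := Nat.cast_nonneg _
    linarith
  -- the prime `l` by counting
  obtain ⟨l, hlp, hl13, hlk, hndvd⟩ := exists_prime_window s hgt hpos hk23 hbudget
  have hl13' : 10000000000000 < l := by norm_num at hl13; exact hl13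
  have hl5 : 5 ≤ l := by omega
  have hl7 : 7 ≤ l := by omega
  have hlne5 : l ≠ 5 := by omega
  have hl0 : 0 < l := by omega
  -- (P2): `l` divides no local height
  have hP2 : Cor22.CondP2 P l := by
    intro v hv
    change ord (CyclotomicField 4 ℚ) v (Cor22.jInv x) < 0 at hv
    intro hdvd
    have hvT : v ∈ Ty := by
      rw [hTy, hy]; exact mem_support_of_ord_jInv_neg hζ hk1 v hv
    have hvs : v ∈ s := Finset.mem_filter.mpr ⟨hvT, hv⟩
    apply hndvd v hvs
    simp only [hhgt]
    have h1 : ((l : ℕ) : ℤ) ∣ ((-ord (CyclotomicField 4 ℚ) v (Cor22.jInv x)).toNat : ℤ) := by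
      rw [Int.toNat_of_nonneg (by omega)]
      exact dvd_neg.mpr hdvd
    exact_mod_cast h1
  have hP5 : Cor22.CondP5 P l := hP5all l hlp hlne5
  -- (P6): the point lies in `K_V = std ∅` and its `log q^∀ ≥ 2k log 5` beats `H_K`
  have hlog5 : (1.386 : ℝ) ≤ Real.log 5 := by
    obtain ⟨hlog2, -⟩ := log_two_bounds
    have h4 : Real.log 4 ≤ Real.log 5 := Real.log_le_log (by norm_num) (by norm_num)
    have hlog4 : Real.log 4 = 2 * Real.log 2 := by
      rw [show (4 : ℝ) = 2 ^ 2 by norm_num, Real.log_pow]; norm_num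
    linarith
  have hstd := mem_std_empty hζ hk1
  have hQall : 2 * k * Real.log 5 ≤ Cor22.logQForall P :=
    logQAvoid_ge hζ hk1 hV hlogV ∅ (by simp)
  have hHKQ : HK < Cor22.logQForall P := by
    have hk0 : (1 : ℝ) ≤ k := by exact_mod_cast hk1
    have h1 : HK ≤ |HK| := le_abs_self HK
    have h2 : (k : ℝ) ≤ 2 * k * Real.log 5 := by nlinarith
    linarith
  have hP6 : Cor22.CondP6 P l := hHK P hstd hUP l hlp hl7 hP2 hP5 hHKQ
  -- `log q^{∤2l} ≥ 2k log 5`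
  have hQ2l : 2 * k * Real.log 5 ≤ Cor22.logQAvoid P {2, l} := by
    refine logQAvoid_ge hζ hk1 hV hlogV {2, l} ?_
    intro p hp
    simp only [Finset.mem_insert, Finset.mem_singleton] at hp
    rcases hp with hp | hp
    · rw [hp]; exact h2V
    · rw [hp]; exact hlV l hlp hlne5
  -- Chebyshev for the prime-counting term at `N = d*·l = 1105920·l`
  have hN : (2 ^ 12 * 3 ^ 3 * 5 * Cor22.dmod P * l) = 1105920 * l := by rw [hdmod]; norm_num
  have hNr : (((2 ^ 12 * 3 ^ 3 * 5 * Cor22.dmod P : ℕ)) : ℝ) = 1105920 := by rw [hdmod]; norm_num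
  have hdr : (Cor22.dmod P : ℝ) = 2 := by rw [hdmod]; norm_num
  have hPi : Real.log ((1105920 : ℝ) * l) * (Nat.primeCounting (1105920 * l) : ℝ) ≤ 5 * (1105920 * l) := by
    have h := Cor22Window.log_mul_primeCounting_le (n := 1105920 * l) (by omega)
    push_cast at h
    exact h
  have hPi0 : (0 : ℝ) ≤ (Nat.primeCounting (1105920 * l) : ℝ) := Nat.cast_nonneg _
  -- log-diff and log-cond of the point
  have hD : P.logDiff = Real.log 4 / 2 := logDiff_eq x
  have hD0 : 0 ≤ P.logDiff := P.logDiff_nonneg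
  have hDle : P.logDiff ≤ 2 := by
    rw [hD]; have := Real.log_le_sub_one_of_pos (by norm_num : (0 : ℝ) < 4); linarith
  have hC0 : 0 ≤ Cor22.logCondAvoid P {2, l} := Cor22.logCondAvoid_nonneg P {2, l}
  have hCle : Cor22.logCondAvoid P {2, l} ≤ 5 + 124 * k := by
    have h1 := logCondAvoid_le hζ hk1 {2, l}
    have h2 : Real.log (6 * 125 ^ k) ≤ 5 + 124 * k := by
      rw [Real.log_mul (by norm_num) (by positivity), Real.log_pow]
      have h6 := Real.log_le_sub_one_of_pos (by norm_num : (0 : ℝ) < 6)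
      have h125 := Real.log_le_sub_one_of_pos (by norm_num : (0 : ℝ) < 125)
      have hk0 : (0 : ℝ) ≤ k := Nat.cast_nonneg _
      have h3 : (k : ℝ) * Real.log 125 ≤ (k : ℝ) * 124 := mul_le_mul_of_nonneg_left (by linarith) hk0
      linarith
    exact h1.trans h2
  -- the threshold antecedent of the stub holds at `(P, l)`
  have hthr : 40 * Real.log (((2 ^ 12 * 3 ^ 3 * 5 * Cor22.dmod P : ℕ) : ℝ) * l)
      * ((Nat.primeCounting (2 ^ 12 * 3 ^ 3 * 5 * Cor22.dmod P * l) : ℝ)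
        - (2 * (Cor22.dmod P : ℝ) * (P.logDiff + Cor22.logCondAvoid P {2, l}) + Real.log (2 * 3 * 5 * (l : ℝ)))
          / Real.log 2) < Cor22.logQAvoid P {2, l} := by
    rw [hN, hNr, hdr]
    have hlog2 : 0 < Real.log 2 := Real.log_pos (by norm_num)
    have hl1 : (1 : ℝ) ≤ l := by exact_mod_cast hl0
    have hlogN : 0 ≤ Real.log ((1105920 : ℝ) * l) := Real.log_nonneg (by linarith)
    have hsub : 0 ≤ (2 * (2 : ℝ) * (P.logDiff + Cor22.logCondAvoid P {2, l}) + Real.log (2 * 3 * 5 * (l : ℝ))) / Real.log 2 := by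
      refine div_nonneg ?_ hlog2.le
      have : 0 ≤ Real.log (2 * 3 * 5 * (l : ℝ)) := Real.log_nonneg (by linarith)
      linarith [mul_nonneg (by norm_num : (0 : ℝ) ≤ 2 * 2) (add_nonneg hD0 hC0)]
    have hlk' : (500000000 : ℝ) * l ≤ k := by exact_mod_cast hlk
    have h1 : 40 * Real.log ((1105920 : ℝ) * l) * ((Nat.primeCounting (1105920 * l) : ℝ)
        - (2 * (2 : ℝ) * (P.logDiff + Cor22.logCondAvoid P {2, l}) + Real.log (2 * 3 * 5 * (l : ℝ))) / Real.log 2)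
        ≤ 40 * (Real.log ((1105920 : ℝ) * l) * (Nat.primeCounting (1105920 * l) : ℝ)) := by
      have := mul_le_mul_of_nonneg_left
        (sub_le_self ((Nat.primeCounting (1105920 * l) : ℝ)) hsub) (mul_nonneg (by norm_num : (0:ℝ) ≤ 40) hlogN)
      linarith [this]
    have h2k : (2 * k : ℝ) * Real.log 5 ≥ 2 * k * 1.386 := by nlinarith [hlog5]
    linarith
  -- the witness: at `(P, l)` a datum exists, and any datum-level pair bound with the slack contradicts the numerics
  refine ⟨P, l, hUP, hlp, hl13, hcore, hP2, hP5, hP6, hdmod, hthr,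
    ThetaPartII.stub_thetaData P hUP l hlp hl5 hcore hP2 hP5 hP6, fun T hpair => ?_⟩
  -- transported to the point at the split prime `5 = V·W`: `(l+1)·(2k)·log 5/48 ≤ slack(P,l)`
  have key := PointDict.splitDepth_le_of_datumPair (l := l) (F := CyclotomicField 4 ℚ) (x := x)
    (S := ((l : ℝ) + 1) / 4 *
        ((1 + 12 * (Cor22.dmod P : ℝ) / l) * (P.logDiff + Cor22.logCondAvoid P {2, l})
          + 2 * Real.log l + 52
          + 20 / 3 * Real.log (((2 ^ 12 * 3 ^ 3 * 5 * Cor22.dmod P : ℕ) : ℝ) * (l : ℝ))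
            * (Nat.primeCounting (2 ^ 12 * 3 ^ 3 * 5 * Cor22.dmod P * l) : ℝ))
      - (((l : ℝ) + 5) / 4 - (Cor22.dmod P : ℝ)) * (P.logDiff + (1 - 1 / (l : ℝ)) * Cor22.logCondAvoid P {2, l}))
    T hpair hl0 htop (p := 5) V.2 W.2 (M := 2 * k) (by omega) hjv hjw h2V (hlV l hlp hlne5) hwV hwW hnV hlogV
  -- … while `slack(P,l) < (l+1)·(2k)·log 5/48`
  have hlt := slack_lt_pair hl13 hlk hD0 hDle hC0 hCle hPi
  rw [hN, hNr, hdr] at key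
  push_cast at key
  linarith

end Summit.ABC.ABC.Theorems.ThetaPartII.Negative

end
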